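import Literature.MathematicalPhysics.QuantumLattice.KagomeLatticeDegreeProofs
import HarnessLib

/-!
# The kagome lattice (`kagomeGraph`): doubled positions, the 1-Lipschitz coordinates `pos₀, pos₁`, and the central INVERSION
# `(y, r) ↦ (−y − kagomeOffset r, r)` (`pos ↦ −pos`) as an automorphism

builds on p205010 (kernel theorem, internal audit signed; external expert review pending) — nothing in this file uses p205010.
Lane `prim-bschramm`, seat `prim-bschramm-p4` (gen 8; PART C3, class map); helper file (`--supports stmt-CriticalPhenomena-4575 --as helper`).
Geometry layer of `KagomeZSign` (the stacked kagome lattice as a three-type customer of the D″ v2 node).  The kagome lattice is the tree's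
`kagomeGraph` on `KagomeVertex = Site 2 × Fin 3` (adjacency table `KagomeAdjRel`; the site `(x, s)` is the midpoint of the edge of `𝕋` from the
cell `x` in direction `kagomeOffset s ∈ {e₀, e₁, e₀ + e₁}`).
* `KagZ.pos (x, s) = 2x + kagomeOffset s` (doubled position), `KagZ.ψ = pos₀`, `KagZ.η = pos₁`, `KagZ.adj_bound` (both move by `≤ 1` along a bond);
* `KagZ.adj_of_rel`, `adj_cell`, `adj_two_one`, `adj_two_zero`, `adj_one_zero` (the bonds of the table);
* `KagZ.invIso` (the central inversion is an automorphism: up triangles ↔ down triangles, `rel_inv`), `KagZ.shiftIso` (tree translations),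
  `pos_shift`, `pos_inv`.
[cite: SavaryBalents2017, §5 (the kagome lattice of corner-sharing triangles)] [cite: GrimmettPercolation1999, §12.1 p. 349]
-/

noncomputable section

namespace Summit.CriticalPhenomena.PercolationContinuityZ3.Theorems.Transplant

namespace KagZ

open MeasureTheory Literature.Probability.Percolation Literature.Probability.LatticeModels SimpleGraph
open Literature.MathematicalPhysics.QuantumLattice
open scoped Classical

/-! ## §1 Doubled positions, the Lipschitz bounds, the central inversion -/

/-- `e₀ ∈ ℤ²`. [folklore] -/
abbrev u0 : Site 2 := Pi.single 0 1
/-- `e₁ ∈ ℤ²`. [folklore] -/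
abbrev u1 : Site 2 := Pi.single 1 1

/-- `kagomeOffset 0 = e₀`. [folklore] -/
@[simp] theorem kagomeOffset_zero : kagomeOffset 0 = u0 := rfl
/-- `kagomeOffset 1 = e₁`. [folklore] -/
@[simp] theorem kagomeOffset_one : kagomeOffset 1 = u1 := rfl
/-- `kagomeOffset 2 = e₀ + e₁`. [folklore] -/
@[simp] theorem kagomeOffset_two : kagomeOffset 2 = u0 + u1 := rfl

/-- **The doubled position** of a kagome site: `pos(x, s) = 2x + kagomeOffset s` (twice the midpoint of its edge of `𝕋`). [cite: SavaryBalents2017, §5] -/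
def pos (w : KagomeVertex) : Site 2 := 2 • w.1 + kagomeOffset w.2

/-- The height `ψ = pos₀`. [folklore] -/
def ψ (w : KagomeVertex) : ℤ := pos w 0
/-- The transverse height `η = pos₁`. [folklore] -/
def η (w : KagomeVertex) : ℤ := pos w 1

/-- `ψ` in coordinates. [folklore] -/
theorem ψ_mk (x : Site 2) (s : Fin 3) : ψ (x, s) = 2 * x 0 + kagomeOffset s 0 := by simp [ψ, pos]
/-- `η` in coordinates. [folklore] -/
theorem η_mk (x : Site 2) (s : Fin 3) : η (x, s) = 2 * x 1 + kagomeOffset s 1 := by simp [η, pos]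

/-- The one-sided table bounds both coordinates of `pos` by one along a bond. [cite: SavaryBalents2017, §5 Fig. 12] -/
theorem rel_bound {a b : KagomeVertex} (h : KagomeAdjRel ℤ a b) : |ψ a - ψ b| ≤ 1 ∧ |η a - η b| ≤ 1 := by
  obtain ⟨x, s⟩ := a
  obtain ⟨y, r⟩ := b
  simp only [KagomeAdjRel] at h
  simp only [ψ_mk, η_mk]
  rcases h with ⟨h1, -⟩ | ⟨rfl, rfl, h1⟩ | ⟨rfl, rfl, h1⟩ | ⟨rfl, rfl, h1⟩
  · subst h1
    fin_cases s <;> fin_cases r <;> simp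
  · subst h1
    constructor
    · simp [abs_le]; omega
    · simp
  · subst h1
    constructor
    · simp
    · simp [abs_le]; omega
  · subst h1
    constructor
    · simp [abs_le]; omega
    · simp [abs_le]; omega

/-- **`ψ` and `η` are 1-Lipschitz along kagome bonds.** [cite: SavaryBalents2017, §5] -/
theorem adj_bound {a b : KagomeVertex} (h : kagomeGraph.Adj a b) : |ψ a - ψ b| ≤ 1 ∧ |η a - η b| ≤ 1 := by
  rcases ((kagomeGraph_adj_iff a b).1 h).2 with h' | h'
  · exact rel_bound h'
  · obtain ⟨h1, h2⟩ := rel_bound h'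
    exact ⟨by rw [abs_sub_comm]; exact h1, by rw [abs_sub_comm]; exact h2⟩

/-- A pair in the one-sided table is a bond (the table never relates a site to itself). [cite: SavaryBalents2017, §5] -/
theorem adj_of_rel {a b : KagomeVertex} (h : KagomeAdjRel ℤ a b) : kagomeGraph.Adj a b := by
  refine (kagomeGraph_adj_iff a b).2 ⟨?_, Or.inl h⟩
  rintro rfl
  unfold KagomeAdjRel at h
  rcases h with ⟨-, h⟩ | ⟨h1, h2, -⟩ | ⟨h1, h2, -⟩ | ⟨h1, h2, -⟩
  · exact h rfl
  · rw [h1] at h2; exact absurd h2 (by decide)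
  · rw [h1] at h2; exact absurd h2 (by decide)
  · rw [h1] at h2; exact absurd h2 (by decide)

/-- … and so is the reversed pair. [folklore] -/
theorem adj_of_rel' {a b : KagomeVertex} (h : KagomeAdjRel ℤ b a) : kagomeGraph.Adj a b := (adj_of_rel h).symm

/-- Two sites of one cell are adjacent (the up triangle). [cite: SavaryBalents2017, §5 Fig. 12] -/
theorem adj_cell (x : Site 2) {s r : Fin 3} (h : s ≠ r) : kagomeGraph.Adj (x, s) (x, r) := adj_of_rel (Or.inl ⟨rfl, h⟩)

/-- `(x, 2) ∼ (x + e₀, 1)` (down triangle). [cite: SavaryBalents2017, §5 Fig. 12] -/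
theorem adj_two_one (x : Site 2) : kagomeGraph.Adj (x, 2) (x + u0, 1) := adj_of_rel (Or.inr (Or.inl ⟨rfl, rfl, rfl⟩))

/-- `(x, 2) ∼ (x + e₁, 0)` (down triangle). [cite: SavaryBalents2017, §5 Fig. 12] -/
theorem adj_two_zero (x : Site 2) : kagomeGraph.Adj (x, 2) (x + u1, 0) := adj_of_rel (Or.inr (Or.inr (Or.inl ⟨rfl, rfl, rfl⟩)))

/-- `(x, 1) ∼ (x − e₀ + e₁, 0)` (down triangle). [cite: SavaryBalents2017, §5 Fig. 12] -/
theorem adj_one_zero (x : Site 2) : kagomeGraph.Adj (x, 1) (x - u0 + u1, 0) := adj_of_rel (Or.inr (Or.inr (Or.inr ⟨rfl, rfl, rfl⟩)))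

/-- The central inversion `ι(y, r) = (−y − kagomeOffset r, r)` (`pos ↦ −pos`), as an involution of the vertex set. [folklore] -/
def invEquiv : KagomeVertex ≃ KagomeVertex where
  toFun w := (-w.1 - kagomeOffset w.2, w.2)
  invFun w := (-w.1 - kagomeOffset w.2, w.2)
  left_inv w := by obtain ⟨y, r⟩ := w; simp
  right_inv w := by obtain ⟨y, r⟩ := w; simp

/-- `ι` unfolded. [folklore] -/
@[simp] theorem invEquiv_apply (w : KagomeVertex) : invEquiv w = (-w.1 - kagomeOffset w.2, w.2) := rfl

/-- **`ι` maps the one-sided table into the symmetrised table** (up triangles go to down triangles and conversely). [cite: SavaryBalents2017, §5 Fig. 12] -/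
theorem rel_inv {a b : KagomeVertex} (h : KagomeAdjRel ℤ a b) :
    KagomeAdjRel ℤ (invEquiv a) (invEquiv b) ∨ KagomeAdjRel ℤ (invEquiv b) (invEquiv a) := by
  obtain ⟨x, s⟩ := a
  obtain ⟨y, r⟩ := b
  unfold KagomeAdjRel at h ⊢
  simp only [invEquiv_apply]
  rcases h with ⟨h1, hsr⟩ | ⟨hs, hr, h1⟩ | ⟨hs, hr, h1⟩ | ⟨hs, hr, h1⟩
  · change y = x at h1
    change s ≠ r at hsr
    subst h1
    fin_cases s <;> fin_cases r
    · exact absurd rfl hsr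
    · right; right; right; right; exact ⟨rfl, rfl, by ext i; fin_cases i <;> simp⟩
    · right; right; right; left; exact ⟨rfl, rfl, by ext i; fin_cases i <;> simp⟩
    · left; right; right; right; exact ⟨rfl, rfl, by ext i; fin_cases i <;> simp⟩
    · exact absurd rfl hsr
    · right; right; left; exact ⟨rfl, rfl, by ext i; fin_cases i <;> simp⟩
    · left; right; right; left; exact ⟨rfl, rfl, by ext i; fin_cases i <;> simp⟩
    · left; right; left; exact ⟨rfl, rfl, by ext i; fin_cases i <;> simp⟩
    · exact absurd rfl hsr
  · change s = 2 at hs; change r = 1 at hr; change y = x + Pi.single 0 1 at h1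
    subst hs hr h1
    left; left; exact ⟨by ext i; fin_cases i <;> simp; omega, by decide⟩
  · change s = 2 at hs; change r = 0 at hr; change y = x + Pi.single 1 1 at h1
    subst hs hr h1
    left; left; exact ⟨by ext i; fin_cases i <;> simp; omega, by decide⟩
  · change s = 1 at hs; change r = 0 at hr; change y = x - Pi.single 0 1 + Pi.single 1 1 at h1
    subst hs hr h1
    left; left; exact ⟨by ext i; fin_cases i <;> simp; omega, by decide⟩

/-- **The central inversion is an automorphism of the kagome lattice.** [cite: SavaryBalents2017, §5] -/
def invIso : kagomeGraph ≃g kagomeGraph where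
  toEquiv := invEquiv
  map_rel_iff' := by
    intro a b
    have key : ∀ a b : KagomeVertex, kagomeGraph.Adj a b → kagomeGraph.Adj (invEquiv a) (invEquiv b) := by
      intro a b h
      obtain ⟨hne, h | h⟩ := (kagomeGraph_adj_iff a b).1 h
      · rcases rel_inv h with h' | h'
        · exact adj_of_rel h'
        · exact adj_of_rel' h'
      · rcases rel_inv h with h' | h'
        · exact adj_of_rel' h'
        · exact adj_of_rel h'
    refine ⟨fun h => ?_, key a b⟩
    have h2 := key _ _ h
    rwa [show invEquiv (invEquiv a) = a from invEquiv.left_inv a, show invEquiv (invEquiv b) = b from invEquiv.left_inv b] at h2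

/-- `invIso` unfolded. [folklore] -/
@[simp] theorem invIso_apply (w : KagomeVertex) : invIso w = (-w.1 - kagomeOffset w.2, w.2) := rfl

/-- **Translations are automorphisms** (tree: `kagomeGraph_adj_shift_iff`). [cite: SavaryBalents2017, §5] -/
def shiftIso (v : Site 2) : kagomeGraph ≃g kagomeGraph := ⟨KagomeVertex.shift v, kagomeGraph_adj_shift_iff v _ _⟩

/-- `shiftIso` unfolded. [folklore] -/
@[simp] theorem shiftIso_apply (v : Site 2) (w : KagomeVertex) : shiftIso v w = (w.1 + v, w.2) := rfl

/-- `pos` of a translate. [folklore] -/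
theorem pos_shift (y v : Site 2) (r : Fin 3) : pos (y + v, r) = pos (y, r) + 2 • v := by
  simp only [pos, smul_add]; abel

/-- `pos` of the inverted site. [folklore] -/
theorem pos_inv (y : Site 2) (r : Fin 3) : pos (-y - kagomeOffset r, r) = -pos (y, r) := by
  simp only [pos, smul_sub, smul_neg, two_smul]; abel

end KagZ

end Summit.CriticalPhenomena.PercolationContinuityZ3.Theorems.Transplant

end
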